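import Summits.Ventures.PercRepro.SevenThreePartition
import Summits.Ventures.PercRepro.SevenThreeLineNonneg

/-!
# PercRepro — the `(7,3)` cell: THEOREM P₁(7,3) — `28/5 ≤ supply` (p3, gen 16)

The four parts of `supply − 28/5` (`SevenThreePartition.lean`) are bounded below: the `d = 0` part is `≥ 0`, the
`d = 3` part is `0`, every star fibre is `≥ starBound ℓ₀ / Ls` (`star_fibre_bound`) and every line fibre is
`≥ lineBound ℓ₀ / Lc` (`line_fibre_bound`). For `ℓ₀ ≤ 2` both bounds are `0`. At `ℓ₀ = 3` the COUNTING of mine-2's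
§27.4 (`P3-C025-seven-three-plan.md` §9 (R4)): a line through at most one point of `T` is never negative
(`line_fibre_nonneg_of_k_le_one`, the kernel cells of `SevenThreeLineNonneg.lean`); the lines through two points of
`T` are determined by those two points (`card_lines_two_le_three`: at most `C(3,2) = 3` of them, two points of `T`
being never in series); and the `4` points of `W ∖ L₀` are pairwise non-series (the flat condition), giving at least
`4` star classes each `≥ 3827/94900` (`four_le_card_starClasses`). Hence
`supply − 28/5 ≥ 4·(3827/94900) − 3·(53/4830) > 0`: **`supply_ge_phi`**, Theorem P₁(7,3).
-/

namespace PercRepro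

namespace SevenThree

open Finset ThmH SixThree CycCount LineCount StarApply

variable {α : Type*} [DecidableEq α] {M : Matroid α} [M.Finite]

/-- Two distinct points of `T` are never in series in the world. -/
theorem not_ser_of_mem_T {T W : Finset α} (h : ReducedWorld M T W) (hr : M.eRank = 7) {t t' : α} (ht : t ∈ T)
    (ht' : t' ∈ T) (hne : t ≠ t') : ¬ Ser M (T ∪ W) t t' := by
  rintro (hh | hh)
  · exact hne hh
  · have hW : W ⊆ (T ∪ W) \ {t, t'} := by
      intro w hw
      rw [Finset.mem_sdiff, Finset.mem_insert, Finset.mem_singleton]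
      refine ⟨Finset.mem_union_right T hw, ?_⟩
      rintro (rfl | rfl)
      · exact Finset.disjoint_left.1 h.disj ht hw
      · exact Finset.disjoint_left.1 h.disj ht' hw
    have h1 : nrk M W ≤ nrk M ((T ∪ W) \ {t, t'}) := nrk_mono hW
    rw [nrk_subset_W h (Finset.Subset.refl W), h.W_card, nrk_world h hr] at *
    omega

/-- Points of `T` are non-coloops of the world. -/
theorem T_subset_cyclicPart {T W : Finset α} (h : ReducedWorld M T W) (hr : M.eRank = 7) :
    T ⊆ cyclicPart M (T ∪ W) := by
  intro t ht
  exact Finset.mem_sdiff.2 ⟨Finset.mem_union_left W ht,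
    fun hc => Finset.disjoint_left.1 h.disj ht (coloopsOf_world_subset h hr hc)⟩

/-- **At most three lines through two points of `T`**: such a line is the closure of its two `T`-points. -/
theorem card_lines_two_le_three {T W : Finset α} (h : ReducedWorld M T W) (hr : M.eRank = 7) :
    ((lines M T W).filter (fun lam => (lam ∩ T).card = 2)).card ≤ 3 := by
  have hE := world_subset h
  have hinj : Set.InjOn (fun lam => lam ∩ T) ↑((lines M T W).filter (fun lam => (lam ∩ T).card = 2)) := by
    intro lam hlam lam' hlam' heq
    rw [Finset.mem_coe, Finset.mem_filter] at hlam hlam'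
    obtain ⟨hlamE, hlam2, hlamcl⟩ := line_props hlam.1
    obtain ⟨hlamE', hlam2', hlamcl'⟩ := line_props hlam'.1
    simp only at heq
    -- `P = λ ∩ T` has dual rank `2`
    obtain ⟨t, t', hne, hP⟩ := Finset.card_eq_two.1 hlam.2
    have hPT : lam ∩ T ⊆ T := Finset.inter_subset_right
    have hd : drk M (T ∪ W) (lam ∩ T) = 2 := by
      have h2 : 2 ≤ drk M (T ∪ W) (lam ∩ T) := by
        apply two_le_drk_of_not_ser hE (T_subset_cyclicPart h hr (hPT (by rw [hP]; simp)))
          (by rw [hP]; simp) (by rw [hP]; simp) hne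
        exact not_ser_of_mem_T h hr (hPT (by rw [hP]; simp)) (hPT (by rw [hP]; simp)) hne
      have h3 : drk M (T ∪ W) (lam ∩ T) ≤ 2 := by rw [← hlam2]; exact drk_mono Finset.inter_subset_left
      omega
    have e1 : dcl M T W (lam ∩ T) = lam := by
      rw [dcl_eq_of_subset hlamE (by rw [hlamcl]; exact Finset.inter_subset_left) (by rw [hd, hlam2]), hlamcl]
    have e2 : dcl M T W (lam' ∩ T) = lam' := by
      rw [dcl_eq_of_subset hlamE' (by rw [hlamcl']; exact Finset.inter_subset_left) (by rw [← heq, hd, hlam2']),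
        hlamcl']
    rw [← e1, ← e2, heq]
  have hmaps : ∀ lam ∈ (lines M T W).filter (fun lam => (lam ∩ T).card = 2), lam ∩ T ∈ T.powersetCard 2 := by
    intro lam hlam
    rw [Finset.mem_filter] at hlam
    exact Finset.mem_powersetCard.2 ⟨Finset.inter_subset_right, hlam.2⟩
  have := Finset.card_le_card_of_injOn (fun lam => lam ∩ T) hmaps hinj
  rw [Finset.card_powersetCard, h.T_card] at this
  exact this

/-- **At `ℓ₀ = 3` the four points of `W ∖ L₀` are pairwise non-series** (the flat condition), so at least four series
classes meet `W`. -/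
theorem four_le_card_starClasses {T W : Finset α} (h : ReducedWorld M T W) (hr : M.eRank = 7)
    (hl3 : (coloopsOf M (T ∪ W)).card = 3) :
    4 ≤ ((serClasses M (T ∪ W)).filter (fun N => (N ∩ W).Nonempty)).card := by
  have hE := world_subset h
  have hLW := coloopsOf_world_subset h hr
  set L₀ := coloopsOf M (T ∪ W) with hL₀
  have hW4 : (W \ L₀).card = 4 := by
    rw [Finset.card_sdiff_of_subset hLW, h.W_card, hl3]
  have hcyc : ∀ w ∈ W \ L₀, w ∈ cyclicPart M (T ∪ W) := by
    intro w hw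
    rw [Finset.mem_sdiff] at hw
    exact Finset.mem_sdiff.2 ⟨Finset.mem_union_right T hw.1, hw.2⟩
  -- two points of `W ∖ L₀` are not in series: `E ∖ {w, w'} ⊇ T ∪ {u} ∪ L₀` has rank `7`
  have hns : ∀ w ∈ W \ L₀, ∀ w' ∈ W \ L₀, w ≠ w' → ¬ Ser M (T ∪ W) w w' := by
    intro w hw w' hw' hne hser
    rcases hser with hh | hh
    · exact hne hh
    obtain ⟨u, hu⟩ : ((W \ L₀) \ {w, w'}).Nonempty := by
      apply Finset.card_pos.1
      have := Finset.card_sdiff_add_card_inter (W \ L₀) {w, w'}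
      have h2 : ((W \ L₀) ∩ {w, w'}).card ≤ 2 := (Finset.card_le_card Finset.inter_subset_right).trans
        Finset.card_le_two
      omega
    rw [Finset.mem_sdiff, Finset.mem_sdiff, Finset.mem_insert, Finset.mem_singleton] at hu
    have huW : u ∈ W := hu.1.1
    -- `nrk (insert u T ∪ L₀) = nrk (insert u T) + 3`
    have hsub : insert u T ∪ L₀ ⊆ (T ∪ W) \ {w, w'} := by
      intro e he
      rw [Finset.mem_sdiff, Finset.mem_insert, Finset.mem_singleton]
      rcases Finset.mem_union.1 he with he | he
      · rw [Finset.mem_insert] at he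
        rcases he with rfl | he
        · exact ⟨Finset.mem_union_right T huW, fun hh => hu.2 hh⟩
        · refine ⟨Finset.mem_union_left W he, ?_⟩
          rintro (rfl | rfl)
          · exact Finset.disjoint_left.1 h.disj he (Finset.mem_sdiff.1 hw).1
          · exact Finset.disjoint_left.1 h.disj he (Finset.mem_sdiff.1 hw').1
      · refine ⟨Finset.mem_union_right T (hLW he), ?_⟩
        rintro (rfl | rfl)
        · exact (Finset.mem_sdiff.1 hw).2 he
        · exact (Finset.mem_sdiff.1 hw').2 he
    have hcol : nrk M ((T ∪ W) \ ((T ∪ W) \ (insert u T ∪ L₀) ∪ L₀)) + L₀.card =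
        nrk M ((T ∪ W) \ ((T ∪ W) \ (insert u T ∪ L₀))) := by
      apply nrk_sdiff_union_coloops hE (Finset.Subset.refl _)
      rw [Finset.disjoint_left]
      intro e he heL
      exact (Finset.mem_sdiff.1 he).2 (Finset.mem_union_right _ heL)
    have hA : insert u T ∪ L₀ ⊆ T ∪ W := hsub.trans Finset.sdiff_subset
    rw [Finset.sdiff_sdiff_eq_self hA] at hcol
    have hB : (T ∪ W) \ ((T ∪ W) \ (insert u T ∪ L₀) ∪ L₀) = insert u T := by
      ext e
      constructor
      · intro he
        obtain ⟨heE, hh⟩ := Finset.mem_sdiff.1 he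
        by_contra hins
        apply hh
        apply Finset.mem_union_left
        refine Finset.mem_sdiff.2 ⟨heE, fun hA => ?_⟩
        rcases Finset.mem_union.1 hA with hA | hA
        · exact hins hA
        · exact hh (Finset.mem_union_right _ hA)
      · intro he
        have heA : e ∈ insert u T ∪ L₀ := Finset.mem_union_left _ he
        refine Finset.mem_sdiff.2 ⟨?_, fun hh => ?_⟩
        · rcases Finset.mem_insert.1 he with rfl | he'
          · exact Finset.mem_union_right T huW
          · exact Finset.mem_union_left W he'
        · rcases Finset.mem_union.1 hh with hh1 | hh2
          · exact (Finset.mem_sdiff.1 hh1).2 heA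
          · rcases Finset.mem_insert.1 he with rfl | he'
            · exact hu.1.2 hh2
            · exact Finset.disjoint_left.1 h.disj he' (hLW hh2)
    rw [hB, nrk_insert_T h huW, hl3] at hcol
    have h1 : nrk M (insert u T ∪ L₀) ≤ nrk M ((T ∪ W) \ {w, w'}) := nrk_mono hsub
    have h7 := nrk_world h hr
    omega
  -- the classes of the four points are distinct
  have hinj : Set.InjOn (fun w => serClass M (T ∪ W) w) ↑(W \ L₀) := by
    intro w hw w' hw' heq
    rw [Finset.mem_coe] at hw hw'
    by_contra hne
    apply hns w hw w' hw' hne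
    simp only at heq
    exact ser_of_mem_serClass hE (hcyc w hw) (mem_serClass_self (hcyc w hw))
      (heq ▸ mem_serClass_self (hcyc w' hw'))
  have hmaps : ∀ w ∈ W \ L₀, serClass M (T ∪ W) w ∈ (serClasses M (T ∪ W)).filter (fun N => (N ∩ W).Nonempty) := by
    intro w hw
    rw [Finset.mem_filter]
    exact ⟨mem_serClasses.2 ⟨w, hcyc w hw, rfl⟩,
      ⟨w, Finset.mem_inter.2 ⟨mem_serClass_self (hcyc w hw), (Finset.mem_sdiff.1 hw).1⟩⟩⟩
  have := Finset.card_le_card_of_injOn (fun w => serClass M (T ∪ W) w) hmaps hinj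
  rw [hW4] at this
  exact this

/-- A line through at most one point of `T` has a nonnegative fibre at `ℓ₀ = 3`. -/
theorem line_fibre_nonneg_of_k_le_one {T W lam : Finset α} (h : ReducedWorld M T W) (hr : M.eRank = 7)
    (hlam : lam ∈ lines M T W) (hl3 : (coloopsOf M (T ∪ W)).card = 3) (hk : (lam ∩ T).card ≤ 1) :
    0 ≤ ∑ Z ∈ (lam ∩ W).powerset.filter (fun Z => drk M (T ∪ W) Z = 2), bracket M T (W \ Z) := by
  obtain ⟨hlamE, hlam2, hlamcl⟩ := line_props hlam
  have hLc : (0 : ℚ) < (LineTable.Lc : ℚ) := by exact_mod_cast Lc_pos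
  by_cases hfib : ∃ Z ∈ (lam ∩ W).powerset, drk M (T ∪ W) Z = 2
  · obtain ⟨Z₀, hZ₀, hd⟩ := hfib
    rw [Finset.mem_powerset] at hZ₀
    obtain ⟨-, hlamW5, -⟩ := line_datum_bounds h hr hlamE hlam2 hlamcl hZ₀ hd
    have hL0 := coloops_subset_line h hlamcl
    have hLW := coloopsOf_world_subset h hr
    rw [line_fibre_sum h hr hlamE hlam2 hlamcl]
    apply div_nonneg _ hLc.le
    rw [hl3]
    set A := (lam ∩ W) \ coloopsOf M (T ∪ W) with hAdef
    have hAcyc : A ⊆ cyclicPart M (T ∪ W) := by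
      intro e he
      rw [hAdef, Finset.mem_sdiff, Finset.mem_inter] at he
      exact Finset.mem_sdiff.2 ⟨Finset.mem_union_right T he.1.2, he.2⟩
    have hpair := lineClassList_pairwise (A := A) h
    have hA5 : A.card + (coloopsOf M (T ∪ W)).card ≤ 5 := by
      rw [hAdef, Finset.card_sdiff_of_subset (Finset.subset_inter hL0 hLW)]
      have := Finset.card_le_card (Finset.subset_inter hL0 hLW : coloopsOf M (T ∪ W) ⊆ lam ∩ W)
      omega
    set cs := (lineClassList M T W A).map Finset.card with hcsdef
    have hsum : cs.sum = A.card := by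
      rw [hcsdef, sum_map_card_eq_card_unionL _ hpair, unionL_lineClassList hAcyc]
    have hpos : ∀ x ∈ cs, 1 ≤ x := by
      intro x hx
      rw [hcsdef, List.mem_map] at hx
      obtain ⟨tr, htr, rfl⟩ := hx
      obtain ⟨N, -, hne, rfl⟩ := mem_lineTraces.1 (mem_lineClassList.1 htr)
      exact Finset.card_pos.2 hne
    have hlen : cs.length ≤ 5 := (length_le_sum_of_pos cs hpos).trans (by omega)
    have hsorted : cs.Pairwise (fun a b => b ≤ a) := by
      rw [hcsdef, List.pairwise_map]
      exact lineClassList_sorted T W A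
    have hpad : (cs ++ List.replicate (5 - cs.length) 0).Pairwise (fun a b => b ≤ a) := by
      rw [List.pairwise_append]
      refine ⟨hsorted, List.pairwise_replicate.2 (Or.inr (le_refl 0)), ?_⟩
      intro a _ b hb
      rw [List.mem_replicate] at hb
      omega
    have hlen5 : (cs ++ List.replicate (5 - cs.length) 0).length = 5 := by
      rw [List.length_append, List.length_replicate]
      omega
    have hsum5 : (cs ++ List.replicate (5 - cs.length) 0).sum + 3 ≤ 5 := by
      rw [List.sum_append, List.sum_replicate, smul_zero, add_zero, hsum]
      omega
    have h5 : 0 ≤ LineTable.deltaN (lam ∩ T).card 3 (cs ++ List.replicate (5 - cs.length) 0) := by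
      match cs ++ List.replicate (5 - cs.length) 0, hlen5, hpad, hsum5 with
      | [c1, c2, c3, c4, c5], _, hd, hs =>
        have h21 : c2 ≤ c1 := List.rel_of_pairwise_cons hd (by simp)
        have h32 : c3 ≤ c2 := List.rel_of_pairwise_cons hd.of_cons (by simp)
        have h43 : c4 ≤ c3 := List.rel_of_pairwise_cons hd.of_cons.of_cons (by simp)
        have h54 : c5 ≤ c4 := List.rel_of_pairwise_cons hd.of_cons.of_cons.of_cons (by simp)
        simp only [List.sum_cons, List.sum_nil, add_zero] at hs
        exact LineTable.deltaN_nonneg_of_k_le_one hk h21 h32 h43 h54 (by omega)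
    rw [deltaN_append_zeros] at h5
    exact_mod_cast h5
  · have hempty : (lam ∩ W).powerset.filter (fun Z => drk M (T ∪ W) Z = 2) = ∅ := by
      apply Finset.filter_eq_empty_iff.2
      intro Z hZ hd
      exact hfib ⟨Z, hZ, hd⟩
    rw [hempty, Finset.sum_empty]

/-- A star fibre is empty when the class misses `W`. -/
theorem starFibre_eq_empty {T W N : Finset α} (hNW : ¬ (N ∩ W).Nonempty) : starFibre M T W N = ∅ := by
  unfold starFibre
  apply Finset.filter_eq_empty_iff.2
  intro X _ hX
  obtain ⟨e, he⟩ := hX.2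
  have he' := hX.1 he
  rw [Finset.mem_sdiff, Finset.mem_sdiff] at he
  exact hNW ⟨e, Finset.mem_inter.2 ⟨he', he.1.1⟩⟩

/-- Every line of `lines` carries a witness: `k ≤ 2`. -/
theorem card_inter_T_le_two_of_mem_lines {T W lam : Finset α} (h : ReducedWorld M T W) (hr : M.eRank = 7)
    (hlam : lam ∈ lines M T W) : (lam ∩ T).card ≤ 2 := by
  obtain ⟨hlamE, hlam2, hlamcl⟩ := line_props hlam
  unfold lines at hlam
  rw [Finset.mem_image] at hlam
  obtain ⟨Z, hZ, rfl⟩ := hlam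
  rw [Finset.mem_filter, Finset.mem_powerset] at hZ
  have hZsub : Z ⊆ dcl M T W Z ∩ W := Finset.subset_inter (subset_dcl (hZ.1.trans Finset.subset_union_right)) hZ.1
  exact (line_datum_bounds h hr hlamE hlam2 hlamcl hZsub hZ.2).1

/-- The star part is at least `#{N meets W} · starBound ℓ₀ / Ls`. -/
theorem star_part_ge {T W : Finset α} (h : ReducedWorld M T W) (hr : M.eRank = 7) :
    (((serClasses M (T ∪ W)).filter (fun N => (N ∩ W).Nonempty)).card : ℚ) *
      (((StarTable.starBound (coloopsOf M (T ∪ W)).card : ℤ) : ℚ) / (StarTable.Ls : ℚ)) ≤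
      ∑ N ∈ serClasses M (T ∪ W), ∑ X ∈ starFibre M T W N, bracket M T X := by
  have hpt : ∀ N ∈ serClasses M (T ∪ W), (if (N ∩ W).Nonempty then
      ((StarTable.starBound (coloopsOf M (T ∪ W)).card : ℤ) : ℚ) / (StarTable.Ls : ℚ) else 0) ≤
      ∑ X ∈ starFibre M T W N, bracket M T X := by
    intro N hN
    by_cases hNW : (N ∩ W).Nonempty
    · rw [if_pos hNW]
      exact star_fibre_bound h hr hN hNW
    · rw [if_neg hNW, starFibre_eq_empty hNW, Finset.sum_empty]
  have := Finset.sum_le_sum hpt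
  rw [← Finset.sum_filter, Finset.sum_const, nsmul_eq_mul] at this
  exact this

/-- The line part is at least `#{λ : k = 2} · lineBound ℓ₀ / Lc` at `ℓ₀ = 3` (and `≥ 0` for `ℓ₀ ≤ 2`). -/
theorem line_part_ge {T W : Finset α} (h : ReducedWorld M T W) (hr : M.eRank = 7) :
    (if (coloopsOf M (T ∪ W)).card = 3 then
      (((lines M T W).filter (fun lam => (lam ∩ T).card = 2)).card : ℚ) *
        (((LineTable.lineBound 3 : ℤ) : ℚ) / (LineTable.Lc : ℚ)) else 0) ≤
      ∑ lam ∈ lines M T W, ∑ Z ∈ (lam ∩ W).powerset.filter (fun Z => drk M (T ∪ W) Z = 2), bracket M T (W \ Z) := by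
  by_cases hl3 : (coloopsOf M (T ∪ W)).card = 3
  · rw [if_pos hl3]
    have hpt : ∀ lam ∈ lines M T W, (if (lam ∩ T).card = 2 then
        ((LineTable.lineBound 3 : ℤ) : ℚ) / (LineTable.Lc : ℚ) else 0) ≤
        ∑ Z ∈ (lam ∩ W).powerset.filter (fun Z => drk M (T ∪ W) Z = 2), bracket M T (W \ Z) := by
      intro lam hlam
      obtain ⟨hlamE, hlam2, hlamcl⟩ := line_props hlam
      by_cases hk : (lam ∩ T).card = 2
      · rw [if_pos hk]
        have := line_fibre_bound h hr hlamE hlam2 hlamcl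
        rw [hl3] at this
        exact this
      · rw [if_neg hk]
        have hk2 := card_inter_T_le_two_of_mem_lines h hr hlam
        exact line_fibre_nonneg_of_k_le_one h hr hlam hl3 (by omega)
    have := Finset.sum_le_sum hpt
    rw [← Finset.sum_filter, Finset.sum_const, nsmul_eq_mul] at this
    exact this
  · rw [if_neg hl3]
    apply Finset.sum_nonneg
    intro lam hlam
    obtain ⟨hlamE, hlam2, hlamcl⟩ := line_props hlam
    have := line_fibre_bound h hr hlamE hlam2 hlamcl
    have hl0 := card_coloopsOf_world_le h hr
    have hb : LineTable.lineBound (coloopsOf M (T ∪ W)).card = 0 := by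
      unfold LineTable.lineBound
      rw [if_pos (by omega)]
    rw [hb, Int.cast_zero, zero_div] at this
    exact this

open scoped Classical in
/-- **THEOREM P₁(7,3)**: in a reduced world of a rank-`7` matroid, `28/5 ≤ supply T W`. -/
theorem supply_ge_phi {T W : Finset α} (h : ReducedWorld M T W) (hr : M.eRank = 7) :
    (28 / 5 : ℚ) ≤ supply M T W := by
  have hid := supply_sub_phi_eq_sum_bracket h
  rw [sum_bracket_eq_four_parts h hr] at hid
  have hP0 : 0 ≤ ∑ X ∈ W.powerset.filter (fun X => X ≠ ∅ ∧ drk M (T ∪ W) (W \ X) = 0), bracket M T X := by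
    apply Finset.sum_nonneg
    intro X hX
    rw [Finset.mem_filter, Finset.mem_powerset] at hX
    exact bracket_nonneg_of_drk_zero h hr hX.1 hX.2.2
  have hP3 : ∑ X ∈ W.powerset.filter (fun X => X ≠ ∅ ∧ drk M (T ∪ W) (W \ X) = 3), bracket M T X = 0 := by
    apply Finset.sum_eq_zero
    intro X hX
    rw [Finset.mem_filter, Finset.mem_powerset] at hX
    exact bracket_eq_zero_of_drk_three h hr hX.1 hX.2.1 hX.2.2
  have hstar := star_part_ge h hr
  have hline := line_part_ge h hr
  have hl0 := card_coloopsOf_world_le h hr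
  have hLs : (0 : ℚ) < (StarTable.Ls : ℚ) := by exact_mod_cast Ls_pos
  have hLc : (0 : ℚ) < (LineTable.Lc : ℚ) := by exact_mod_cast Lc_pos
  by_cases hl3 : (coloopsOf M (T ∪ W)).card = 3
  · rw [if_pos hl3] at hline
    rw [hl3] at hstar
    have h4 := four_le_card_starClasses h hr hl3
    have h3 := card_lines_two_le_three h hr
    -- the numbers
    have hsb : ((StarTable.starBound 3 : ℤ) : ℚ) / (StarTable.Ls : ℚ) = 3827 / 94900 := by
      unfold StarTable.starBound StarTable.Ls
      norm_num
    have hlb : ((LineTable.lineBound 3 : ℤ) : ℚ) / (LineTable.Lc : ℚ) = -53 / 4830 := by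
      unfold LineTable.lineBound LineTable.Lc
      norm_num
    rw [hsb] at hstar
    rw [hlb] at hline
    have h4' : (4 : ℚ) * (3827 / 94900) ≤
        (((serClasses M (T ∪ W)).filter (fun N => (N ∩ W).Nonempty)).card : ℚ) * (3827 / 94900) := by
      apply mul_le_mul_of_nonneg_right _ (by norm_num)
      exact_mod_cast h4
    have h3' : (3 : ℚ) * (-53 / 4830) ≤
        (((lines M T W).filter (fun lam => (lam ∩ T).card = 2)).card : ℚ) * (-53 / 4830) := by
      apply mul_le_mul_of_nonpos_right _ (by norm_num)
      exact_mod_cast h3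
    have : (0 : ℚ) ≤ supply M T W - 28 / 5 := by
      rw [hid]
      have : (0 : ℚ) ≤ 4 * (3827 / 94900) + 3 * (-53 / 4830) := by norm_num
      linarith
    linarith
  · rw [if_neg hl3] at hline
    have hsb : ((StarTable.starBound (coloopsOf M (T ∪ W)).card : ℤ) : ℚ) / (StarTable.Ls : ℚ) = 0 := by
      have : StarTable.starBound (coloopsOf M (T ∪ W)).card = 0 := by
        unfold StarTable.starBound
        rw [if_pos (by omega)]
      rw [this, Int.cast_zero, zero_div]
    rw [hsb, mul_zero] at hstar
    have : (0 : ℚ) ≤ supply M T W - 28 / 5 := by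
      rw [hid]
      linarith
    linarith

end SevenThree

end PercRepro
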